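import Summits.HubbardSuperconductivity.HubbardSuperconductivity.Theorems.WidthHaldaneDualExact
import Summits.HubbardSuperconductivity.HubbardSuperconductivity.Theorems.WidthHaldaneBochnerFloor

/-!
# The Feshbach step: a low-energy WINDOW law for the column pair source gives its energy (dual) law

Crux `WidthHaldaneBridge` (stmt-HubbardSuperconductivity-16311; routes `WidthHaldane`, `SeamInduction`).
Card `frustration-cost-duality` (2026-08-17 ideation round, sketch `Cruxes/WidthHaldaneBridge/IdeaSketchK2.lean`)
proposes to prove the crux's pointwise floor on the column pair correlator `G_ψ(r) = tubeColumnPairCorr L M Λ e ψ r`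
through the ENERGY it costs to frustrate the tube by the column pair source
`X_r = Σ_a (Φ_a† Φ_{a+r} + Φ_{a+r}† Φ_a)` (`Re⟨φ, X_r φ⟩ = 2G_φ(r)`; the card's `J_r` is `X_r/2`): by
`Theorems/WidthHaldaneDualExact.lean` (`widthHaldaneBridge_iff_dualBridge`) the crux IS the statement that some
coupling `h > 0` raises the `(N_{L,M}, S^z = 0)` sector minimum by `h·2·floor`. The card's provable step `FeshbachStep`
reduces that energy law to a LOW-ENERGY WINDOW law: if the floor `F ≤ G_φ(r)` holds for every normalised sector
vector `φ` of energy `Re⟨φ, H₀φ⟩ ≤ E₀ + Ω` (not only for ground states), `Ω > 0`, then the energy law holds with the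
SAME floor (the card asked only for `F/2`). This file PROVES it, by a two-case min–max argument that needs no
spectral projection: a unit sector vector inside the window pays `h·2F` at first order; one outside the window has
already paid `Ω ≥ h(2F + 64LM²)`, and `Re⟨φ, X_r φ⟩ ≥ -64LM²` kinematically (Bochner floor + ceiling).

As filed in the sketch, `FeshbachStep` quantified over ALL real `δ`; for `δ < -1` the sector `(N_{L,M}(δ), 0)` is
empty (`N > 2LM`), both sector minima are the junk value `0` and the cost law is FALSE (the window law being
vacuous) — the stub is MISSTATED there; the correct hypothesis is `-1 ≤ δ` (the sector has a unit vector,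
`exists_unit_isGroundStateInSector_tubeH0_tubeFilling`), which every use inside the window `δ ∈ (0, 3/10)` has.

* `exists_minEnergyOn_add_smul_ge_of_window` — GENERIC: `H` Hermitian, `K` a sector with a unit vector, `J` any
  matrix with `-B ≤ Re⟨φ, Jφ⟩` on unit vectors of `K`, and a window law "`Re⟨φ,Hφ⟩ ≤ E_K(H) + Ω ⇒ F ≤ Re⟨φ,Jφ⟩`"
  (`Ω > 0`) give a coupling `ν > 0` with `E_K(H) + ν·F ≤ E_K(H + ν•J)`;
* `neg_tubeColumnPairCorr_zero_le`, `abs_tubeColumnPairCorr_le` — `-G_φ(0) ≤ G_φ(r)`, `|G_φ(r)| ≤ 32LM²` (unit `φ`);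
* **`dualLaw_of_windowLaw`** — the tube statement: a window law for `G` with window `Ω(L, M, r) > 0` at
  `(U, δ ≥ -1)` and constants `(Ξ, A, R, M₂, L₁)` implies the dual (energy) law of
  `WidthHaldaneDualExact` with the same constants; `haldaneLaw_of_windowLaw` — hence the Haldane law itself;
* `feshbachStep` — closed form (the line's registered stub).

Sources: H. Feshbach, Ann. Phys. 5 (1958) 357 (effective low-energy operators — name only; the proof is the
elementary two-case bound); T. Kato, *Perturbation Theory for Linear Operators* (1966) II-§6.1; H. Tasaki,
*Physics and Mathematics of Quantum Many-Body Systems* (2020) §2.2 (variational principle in a sector). No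
definitions, no named facts.
-/

noncomputable section

namespace Summit.HubbardSuperconductivity.HubbardSuperconductivity.Theorems.WidthHaldane

set_option linter.dupNamespace false -- summit = problem name (single-conjunct summit), D-0017

open scoped BigOperators Classical Matrix ComplexConjugate
open Matrix Literature.MathematicalPhysics.QuantumLattice

/-! ### The generic two-case bound -/

section Generic

variable {ι : Type*} [Fintype ι] [DecidableEq ι]

omit [DecidableEq ι] in
/-- **Window law ⇒ energy law** (the Feshbach step, elementary form). Let `H` be Hermitian, `K` a sector
containing a unit vector, `E₀ = minEnergyOn H K`, `J` a matrix whose form is bounded below on unit vectors of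
`K` by `-B`, and suppose the WINDOW LAW: every unit `φ ∈ K` with `Re⟨φ, Hφ⟩ ≤ E₀ + Ω` has `F ≤ Re⟨φ, Jφ⟩`
(`Ω > 0`). Then for the coupling `ν = Ω/(|B| + |F| + 1) > 0`, `E₀ + ν·F ≤ minEnergyOn (H + ν•J) K`: a unit
vector inside the window pays `νF` at first order (and `E₀ ≤ Re⟨φ,Hφ⟩`), one outside has paid `Ω ≥ ν(F + B)`.
[folklore] -/
theorem exists_minEnergyOn_add_smul_ge_of_window {H J : Matrix ι ι ℂ} (hH : H.IsHermitian)
    (K : Submodule ℂ (ι → ℂ)) (hne : ∃ ψ ∈ K, star ψ ⬝ᵥ ψ = 1) {Ω B F : ℝ} (hΩ : 0 < Ω)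
    (hB : ∀ φ ∈ K, star φ ⬝ᵥ φ = 1 → -B ≤ (star φ ⬝ᵥ J *ᵥ φ).re)
    (hwin : ∀ φ ∈ K, star φ ⬝ᵥ φ = 1 → (star φ ⬝ᵥ H *ᵥ φ).re ≤ H.minEnergyOn K + Ω →
      F ≤ (star φ ⬝ᵥ J *ᵥ φ).re) :
    ∃ ν : ℝ, 0 < ν ∧ H.minEnergyOn K + ν * F ≤ (H + ν • J).minEnergyOn K := by
  have hD : 0 < |B| + |F| + 1 := by positivity
  refine ⟨Ω / (|B| + |F| + 1), by positivity, ?_⟩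
  set ν : ℝ := Ω / (|B| + |F| + 1) with hν_def
  have hν : 0 < ν := by positivity
  -- the coupling is small enough: `ν (F + B) ≤ Ω`
  have hsmall : ν * (F + B) ≤ Ω := by
    have h1 : ν * (|B| + |F| + 1) = Ω := by
      rw [hν_def]; field_simp
    have h2 : F + B ≤ |B| + |F| + 1 := by linarith [le_abs_self F, le_abs_self B]
    calc ν * (F + B) ≤ ν * (|B| + |F| + 1) := mul_le_mul_of_nonneg_left h2 hν.le
      _ = Ω := h1
  obtain ⟨ψ₀, hψ₀K, hψ₀⟩ := hne
  refine le_csInf ⟨_, ψ₀, hψ₀K, hψ₀, rfl⟩ ?_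
  rintro _ ⟨φ, hφK, hφ1, rfl⟩
  rw [re_form_add_real_smul]
  have hE₀ : H.minEnergyOn K ≤ (star φ ⬝ᵥ H *ᵥ φ).re := minEnergyOn_le_rayleigh_of_mem hH K hφK hφ1
  by_cases hw : (star φ ⬝ᵥ H *ᵥ φ).re ≤ H.minEnergyOn K + Ω
  · -- inside the window: first order
    have hF := hwin φ hφK hφ1 hw
    nlinarith [mul_le_mul_of_nonneg_left hF hν.le]
  · -- outside the window: the window itself pays
    push Not at hw
    have hJ := hB φ hφK hφ1
    nlinarith [mul_le_mul_of_nonneg_left hJ hν.le]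

end Generic

/-! ### Kinematic range of the column pair correlator -/

section Tube

variable (L M : ℕ) [NeZero L] [NeZero M] (Λ : Type) [LinearOrder Λ] [Fintype Λ]
  (e : Λ ≃ ZMod L × ZMod M)

/-- **`-G_φ(0) ≤ G_φ(r)`** for every Fock vector and every displacement (Bochner floor
`2‖Δφ‖²/L - G_φ(0) ≤ G_φ(r)` with `‖Δφ‖² = Σ_{r'} G_φ(r') ≥ 0`). [folklore] -/
theorem neg_tubeColumnPairCorr_zero_le (φ : Fock (Orb Λ)) (r : ZMod L) :
    -tubeColumnPairCorr L M Λ e φ 0 ≤ tubeColumnPairCorr L M Λ e φ r := by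
  have hb := tubeColumnPairCorr_bochnerFloor L M Λ e φ r
  have hS : 0 ≤ ∑ r' : ZMod L, tubeColumnPairCorr L M Λ e φ r' := by
    rw [sum_tubeColumnPairCorr_eq, ← eucNorm_sq]
    exact sq_nonneg _
  have hL : (0 : ℝ) < L := by exact_mod_cast Nat.pos_of_ne_zero (NeZero.ne L)
  have h2 : 0 ≤ 2 * (∑ r' : ZMod L, tubeColumnPairCorr L M Λ e φ r') / L :=
    div_nonneg (mul_nonneg zero_le_two hS) hL.le
  linarith

/-- **`|G_φ(r)| ≤ 32·L·M²`** for every unit vector and every displacement (the kinematic ceiling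
`G_φ(0) ≤ 32LM²` on both sides). [folklore] -/
theorem abs_tubeColumnPairCorr_le {φ : Fock (Orb Λ)} (hφ : star φ ⬝ᵥ φ = 1) (r : ZMod L) :
    |tubeColumnPairCorr L M Λ e φ r| ≤ 32 * (L : ℝ) * (M : ℝ) ^ 2 := by
  have h0 := tubeColumnPairCorr_zero_le L M Λ e hφ
  have h1 := neg_tubeColumnPairCorr_zero_le L M Λ e φ r
  have h2 := tubeColumnPairCorr_le_zero L M Λ e φ r
  exact abs_le.mpr ⟨by linarith, h2.trans h0⟩

/-- The form of the column pair source on a unit vector is at least `-64·L·M²`. [folklore] -/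
theorem neg_le_re_form_columnPairSource {φ : Fock (Orb Λ)} (hφ : star φ ⬝ᵥ φ = 1) (r : ZMod L) :
    -(64 * (L : ℝ) * (M : ℝ) ^ 2) ≤
      (star φ ⬝ᵥ (∑ a : ZMod L, ((∑ b : ZMod M, tubeDWavePair L M Λ e (e.symm (a, b)))ᴴ *
          (∑ b : ZMod M, tubeDWavePair L M Λ e (e.symm (a + r, b))) +
        (∑ b : ZMod M, tubeDWavePair L M Λ e (e.symm (a + r, b)))ᴴ *
          (∑ b : ZMod M, tubeDWavePair L M Λ e (e.symm (a, b))))) *ᵥ φ).re := by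
  rw [re_form_columnPairSource]
  have h := (abs_le.mp (abs_tubeColumnPairCorr_le L M Λ e hφ r)).1
  linarith

/-! ### The tube statement: window law ⇒ dual law ⇒ Haldane law -/

/-- **WINDOW LAW ⇒ DUAL (ENERGY) LAW** on the pure tubes. Fix `U`, `δ ≥ -1`, constants `(Ξ, A, R, M₂, L₁)` and a
window `Ω(L, M, r) > 0`. If for every admissible tube, every admissible displacement `r` and EVERY normalised
`(N_{L,M}(δ), S^z = 0)` sector vector `φ` of energy `Re⟨φ, H₀ φ⟩ ≤ E₀ + Ω(L, M, r̂…)` the floor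
`A·L·M²·r̂^{-Ξ√(ẽ″/ρ̃)/M} ≤ G_φ(r)` holds, then for every admissible tube and displacement some coupling `h > 0` of
the column pair source `X_r` raises the sector minimum by at least `h·2·floor` — the dual law of
`WidthHaldaneDualExact` with the SAME constants. [folklore] -/
theorem dualLaw_of_windowLaw {U δ Ξ A : ℝ} {R M₂ L₁ : ℕ} (hδ : -1 ≤ δ) (Ω : ℕ → ℕ → ℕ → ℝ)
    (hΩ : ∀ L M n, 0 < Ω L M n)
    (hwin : ∀ (L M : ℕ) [NeZero L] [NeZero M], Even L → Even M → M₂ ≤ M → M ≤ L → L₁ ≤ L →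
      ∀ (Λ : Type) [LinearOrder Λ] [Fintype Λ] (e : Λ ≃ ZMod L × ZMod M) (r : ZMod L),
        R ≤ r.val → r.val + R ≤ L →
          ∀ φ : Fock (Orb Λ), φ ∈ szSector (tubeFilling L M δ) 0 → star φ ⬝ᵥ φ = 1 →
            (expect (tubeH0 L M Λ e U) φ).re ≤
                (tubeH0 L M Λ e U).minEnergyOn (szSector (tubeFilling L M δ) 0) + Ω L M r.val →
              A * (L : ℝ) * (M : ℝ) ^ 2 * ((min r.val (L - r.val) : ℕ) : ℝ) ^
                  (-(Ξ * Real.sqrt (tubePairCompressibility L M Λ e U δ / tubeStiffness L M Λ e U δ) / (M : ℝ))) ≤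
                tubeColumnPairCorr L M Λ e φ r) :
    ∀ (L M : ℕ) [NeZero L] [NeZero M], Even L → Even M → M₂ ≤ M → M ≤ L → L₁ ≤ L →
      ∀ (Λ : Type) [LinearOrder Λ] [Fintype Λ] (e : Λ ≃ ZMod L × ZMod M) (r : ZMod L),
        R ≤ r.val → r.val + R ≤ L →
          ∃ h : ℝ, 0 < h ∧
            (tubeH0 L M Λ e U).minEnergyOn (szSector (tubeFilling L M δ) 0) +
                h * (2 * (A * (L : ℝ) * (M : ℝ) ^ 2 * ((min r.val (L - r.val) : ℕ) : ℝ) ^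
                  (-(Ξ * Real.sqrt (tubePairCompressibility L M Λ e U δ / tubeStiffness L M Λ e U δ) / (M : ℝ))))) ≤
              (tubeH0 L M Λ e U + h • (∑ a : ZMod L,
                ((∑ b : ZMod M, tubeDWavePair L M Λ e (e.symm (a, b)))ᴴ *
                    (∑ b : ZMod M, tubeDWavePair L M Λ e (e.symm (a + r, b))) +
                  (∑ b : ZMod M, tubeDWavePair L M Λ e (e.symm (a + r, b)))ᴴ *
                    (∑ b : ZMod M, tubeDWavePair L M Λ e (e.symm (a, b)))))).minEnergyOn
                (szSector (tubeFilling L M δ) 0) := by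
  intro L M _ _ hLe hMe hM hML hL Λ _ _ e r hr hrL
  obtain ⟨ψ₀, hψ₀1, hψ₀gs⟩ := exists_unit_isGroundStateInSector_tubeH0_tubeFilling L M Λ e U hδ
  have hne : ∃ ψ ∈ szSector (Λ := Λ) (tubeFilling L M δ) 0, star ψ ⬝ᵥ ψ = 1 := ⟨ψ₀, hψ₀gs.1, hψ₀1⟩
  refine exists_minEnergyOn_add_smul_ge_of_window (isHermitian_tubeH0 L M Λ e U)
    (szSector (tubeFilling L M δ) 0) hne (hΩ L M r.val)
    (fun φ _ hφ1 => neg_le_re_form_columnPairSource L M Λ e hφ1 r) fun φ hφK hφ1 hw => ?_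
  rw [re_form_columnPairSource]
  have key := hwin L M hLe hMe hM hML hL Λ e r hr hrL φ hφK hφ1 (by rwa [expect])
  linarith

/-- **WINDOW LAW ⇒ HALDANE LAW** with the same constants (the dual law above composed with
`haldaneLaw_of_dualLaw`). [folklore] -/
theorem haldaneLaw_of_windowLaw {U δ Ξ A : ℝ} {R M₂ L₁ : ℕ} (hδ : -1 ≤ δ) (Ω : ℕ → ℕ → ℕ → ℝ)
    (hΩ : ∀ L M n, 0 < Ω L M n)
    (hwin : ∀ (L M : ℕ) [NeZero L] [NeZero M], Even L → Even M → M₂ ≤ M → M ≤ L → L₁ ≤ L →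
      ∀ (Λ : Type) [LinearOrder Λ] [Fintype Λ] (e : Λ ≃ ZMod L × ZMod M) (r : ZMod L),
        R ≤ r.val → r.val + R ≤ L →
          ∀ φ : Fock (Orb Λ), φ ∈ szSector (tubeFilling L M δ) 0 → star φ ⬝ᵥ φ = 1 →
            (expect (tubeH0 L M Λ e U) φ).re ≤
                (tubeH0 L M Λ e U).minEnergyOn (szSector (tubeFilling L M δ) 0) + Ω L M r.val →
              A * (L : ℝ) * (M : ℝ) ^ 2 * ((min r.val (L - r.val) : ℕ) : ℝ) ^
                  (-(Ξ * Real.sqrt (tubePairCompressibility L M Λ e U δ / tubeStiffness L M Λ e U δ) / (M : ℝ))) ≤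
                tubeColumnPairCorr L M Λ e φ r) :
    HaldaneLaw U δ Ξ A R M₂ L₁ :=
  haldaneLaw_of_dualLaw (dualLaw_of_windowLaw hδ Ω hΩ hwin)

end Tube

/-- **FESHBACH STEP, closed form** (card `frustration-cost-duality`, corrected: `-1 ≤ δ` so that the sector is
non-empty; all binders universally quantified): a low-energy window law for the column pair correlator with a
positive window implies the dual (energy) law of the column pair source with the same constants. [folklore] -/
theorem feshbachStep : ∀ (U δ Ξ A : ℝ) (R M₂ L₁ : ℕ) (Ω : ℕ → ℕ → ℕ → ℝ), -1 ≤ δ → (∀ L M n, 0 < Ω L M n) →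
    (∀ (L M : ℕ) [NeZero L] [NeZero M], Even L → Even M → M₂ ≤ M → M ≤ L → L₁ ≤ L →
      ∀ (Λ : Type) [LinearOrder Λ] [Fintype Λ] (e : Λ ≃ ZMod L × ZMod M) (r : ZMod L),
        R ≤ r.val → r.val + R ≤ L →
          ∀ φ : Fock (Orb Λ), φ ∈ szSector (tubeFilling L M δ) 0 → star φ ⬝ᵥ φ = 1 →
            (expect (tubeH0 L M Λ e U) φ).re ≤
                (tubeH0 L M Λ e U).minEnergyOn (szSector (tubeFilling L M δ) 0) + Ω L M r.val →
              A * (L : ℝ) * (M : ℝ) ^ 2 * ((min r.val (L - r.val) : ℕ) : ℝ) ^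
                  (-(Ξ * Real.sqrt (tubePairCompressibility L M Λ e U δ / tubeStiffness L M Λ e U δ) / (M : ℝ))) ≤
                tubeColumnPairCorr L M Λ e φ r) →
    ∀ (L M : ℕ) [NeZero L] [NeZero M], Even L → Even M → M₂ ≤ M → M ≤ L → L₁ ≤ L →
      ∀ (Λ : Type) [LinearOrder Λ] [Fintype Λ] (e : Λ ≃ ZMod L × ZMod M) (r : ZMod L),
        R ≤ r.val → r.val + R ≤ L →
          ∃ h : ℝ, 0 < h ∧
            (tubeH0 L M Λ e U).minEnergyOn (szSector (tubeFilling L M δ) 0) +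
                h * (2 * (A * (L : ℝ) * (M : ℝ) ^ 2 * ((min r.val (L - r.val) : ℕ) : ℝ) ^
                  (-(Ξ * Real.sqrt (tubePairCompressibility L M Λ e U δ / tubeStiffness L M Λ e U δ) / (M : ℝ))))) ≤
              (tubeH0 L M Λ e U + h • (∑ a : ZMod L,
                ((∑ b : ZMod M, tubeDWavePair L M Λ e (e.symm (a, b)))ᴴ *
                    (∑ b : ZMod M, tubeDWavePair L M Λ e (e.symm (a + r, b))) +
                  (∑ b : ZMod M, tubeDWavePair L M Λ e (e.symm (a + r, b)))ᴴ *
                    (∑ b : ZMod M, tubeDWavePair L M Λ e (e.symm (a, b)))))).minEnergyOn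
                (szSector (tubeFilling L M δ) 0) :=
  fun _U _δ _Ξ _A _R _M₂ _L₁ Ω hδ hΩ hwin => dualLaw_of_windowLaw hδ Ω hΩ hwin

end Summit.HubbardSuperconductivity.HubbardSuperconductivity.Theorems.WidthHaldane

end
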